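import Summits.QuantumFields.YangMills.Theorems.BalabanUVNodesN15KingModelFullPropagatorByPartsLetters
import Summits.QuantumFields.YangMills.Theorems.BalabanUVNodesN15FullPropagatorMatrixEntry2Rows
import Summits.QuantumFields.YangMills.Theorems.BalabanUVNodesN15SiteScalarLayerMassless
import HarnessLib

/-!
# BalabanUVNodes ∕ N15 — THE KING-MODEL RUNG, PART Σ-cM: THE SHIFT-DEFECT ROW LETTER ⊗ COLOUR — `𝔇(S′_{+κ} ⊗ 1, S_{+κ} ⊗ 1)∘(C_a∘Σ_ν((A₀⁻¹ ⊗ 1)N∇*_ν)pr_ν)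
# ≤ C·(o₁ + a₀(L^K)^{−α})·e^{−δ|y−y′|_T}` for COLOUR-MIXING coefficient operators `C_a` on King's full `A = 0` propagator `⊗ 1_ι`, on the CLOSED mass range
# (Track A, DAG node N15 = NE2; FAN-OUT v1.1 §N15 s3 «KING-MODEL ∕ RIEMANN-KERNEL RUNG»; the letter `hDSh` of dag-n15-c's FILE 23 at the curved King family)

HONEST FRAMING.  Count-neutral KNIT plumbing (cell `pub-ymgap`, seat `pub-ymgap-dag-n15-d` g19; `--kind proof --supports stmt-QuantumFields-27366 --as helper` = K3⁸
`SpineGivenEndpointR13SepCoPHV`).  No new analytic estimate: the inputs are dag-n15-e's part Σ-c (`hasMaj_oneStepFwd_kingSOp` ⇐ part W-b `fullPropAdjOp_holder_le`, [B9] (3.43)₂ at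
`U ≡ 1`; `hasMaj_shiftT_comp`; `underPtN_add_unitVec`), part Σ-a `hasMaj_kingSOp` (⇐ part Ψ-e), dag-n15-c's FILE 15 bridges (`comp_fgradAdj_liftEquiv`, `sub_id_comp_tensorId`) and M4
lift (`tensorId`, `hasMaj_tensorId`), and dag-n15-w1's part VII massless device (`hasMaj_ofBlocks_of_massLimit`, `continuousAt_kingGOp_mass`); nothing in the tree is modified.

WHY.  dag-n15-c's transport-generic by-parts entry-2 theorem `hasMaj_entry2_byParts_matrix₂_of_letters` (FILE 23) — the door for entry 2 (`X∇*`) of [B9] (3.42) for the curved King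
family (dag-n15-w1 parts XXXVI ∕ XL ∕ XLII; this lineage's g18 architecture note) — displays the SHIFT-DEFECT ROW LETTER `hDSh` on the COLOURED site carrier `X × ι` with a
colour-MIXING matrix coefficient operator `M_{A_μ∘τ_μ⁻¹}` (dag-n15-c `mmulOp`): NOT a componentwise lift of part Σ-c's scalar letter ★★ `hasMaj_shiftDefect_kingS`.  This file is its
colour edition at King's `A = 0` model, proved by the product-carrier twin of Σ-c §2–§4 (template: dag-n15-c FILE 15 ★★ `hasMaj_shiftDefect_fullGM`, the same lift for Bałaban's `gOp`
on the BOND carrier): through King's point pairing lifted to `ι`-coloured site fields the defect of the two lifted forward shifts VANISHES on the upper block face and is minus the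
one-step forward difference inside (§1); `(S_{+κ} − 1)C_aΣ = (C_a⁺ − C_a)S_{+κ}Σ + C_a(S_{+κ} − 1)Σ` costs the oscillation letter `o₁` resp. the Hölder step of `A₀⁻¹N∇*` (Σ-c
`hasMaj_oneStepFwd_kingSOp` tensored with `1_ι`) (§2); the positive-mass letter passes to `m² = 0` by continuity of every matrix element (§3).

CONTENTS ([folklore] bookkeeping + the cited inputs; 0 def).
* §1 `idef_shiftT_lift_apply`, ★ `hasMaj_idefShiftT_comp_lift`, `hasMaj_shiftT_comp_lift` (the device on `Tor (fine (L^K) M) × ι` through `liftMap (underPtN L K n M) ι`).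
* §2 ★★ **`hasMaj_shiftDefect_kingSM`** (`0 < m² ≤ m₀²`, generic intertwining data `(C_a, C_a⁺, a₀, o₁)`).
* §3 `continuousAt_linearMap_apply_of_coords`, `continuousAt_shiftDefect_kingSM_mass`, ★★ **`hasMaj_shiftDefect_kingSM_massRange`** (`0 ≤ m² ≤ m₀²`).

HONEST SCOPE ∕ LIMITS.  `A = 0`, periodic b.c., odd `L ≥ 3`, cubes `2L^e`, `K ≥ 1`, any `n`, `0 ≤ m² ≤ m₀²`, `0 < α < 1`; sharp block sup sizes; the coefficient operator and its
letters DISPLAYED (the species' business: dag-n15-c FILE 12∕13 `pull_comp_mmulOp_translate'` ∕ `hasMaj_mmulOp` ∕ `hasMaj_mmulOp_sub_translate` produce them from row sums); King's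
spelling ([King1986] (2.13) p. 653), NOT Bałaban's covariant `G(U)`; one letter of one entry — not a (3.42) entry, not a node face.  NE2⁺ NOT PRINTED ∕ not proved ∕ not claimed;
N15 NOT discharged; count-neutral; nothing continuum ∕ ℝ⁴ ∕ OS ∕ mass-gap ∕ Clay.  0 `sorry`, 0 `def`, standard axioms.
Locators: [Balaban1985BackgroundPropagators] Thm 3.1 (3.42)–(3.43) pp. 397–398, (3.52) p. 400, (3.64)–(3.65) p. 402 (mechanism); [Balaban1984PropagatorsII] (2.156) p. 250 (the
`U ≡ 1` propagator on `𝔤`-valued fields); [King1986] (2.13) p. 653, p. 664 (pairing), (4.1)–(4.5) p. 670; [Balaban1984PropagatorsI] Prop. 1.2 (1.110)–(1.111) p. 35 (shape), p. 25.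
-/

noncomputable section

namespace Summit.QuantumFields.YangMills.BalabanUVNodes.N15.KingModel

open Real Finset Matrix Filter
open scoped Topology
open Literature.MathematicalPhysics.QuantumFieldTheory.Balaban1983to89
open Literature.MathematicalPhysics.QuantumFieldTheory.Balaban1983to89.B11SectG (BlockNorm HasMaj)
open Literature.MathematicalPhysics.QuantumFieldTheory.Balaban1983to89.B11AxialTransport190 (abs_le_loc_ofBlocks loc_ofBlocks_le)
open Literature.MathematicalPhysics.QuantumFieldTheory.Balaban1983to89.T4EtaRateDefect (idef idef_apply)
open Literature.MathematicalPhysics.QuantumFieldTheory.Balaban1983to89.T4EtaRateCoeffDefect (pull pull_apply diagK)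
open Literature.MathematicalPhysics.QuantumFieldTheory.Balaban1983to89.B5Prop11Plancherel (Tor fine unitVec)
open Literature.MathematicalPhysics.QuantumFieldTheory.King1986.Torus (blockOf tdistT tdistT_nonneg tdistT_symm tdistT_triangle)
open Summit.QuantumFields.YangMills.BalabanUVNodes.N15.VectorPiece (unitTorusGeoS hasMaj_pull_comp tensorId tensorId_apply hasMaj_tensorId)
open Summit.QuantumFields.YangMills.BalabanUVNodes.N15.MatrixSpecies (liftMap liftBlk liftEquiv liftEquiv_apply)
open Summit.QuantumFields.YangMills.BalabanUVNodes.N15.BackgroundLayer (sumJ sumJ_apply fgradAdj hasMaj_sumJ_exp comp_sumJ sub_id_comp_comp_eq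
  tdistT_blockOf_add_unitVec_le comp_fgradAdj_liftEquiv sub_id_comp_tensorId)
open Summit.QuantumFields.YangMills.BalabanUVNodes.N15.SiteLayer (hasMaj_diagK_comp_exp hasMaj_add_exp)
open Summit.QuantumFields.YangMills.BalabanUVNodes.N15.SiteLayerBg (hasMaj_ofBlocks_of_massLimit continuousAt_kingGOp_mass)
open Summit.QuantumFields.YangMills.BalabanUVNodes.N15KingModelRung.Curved

variable {d : ℕ} (L : ℕ) [NeZero L]

/-! ## §1 The device on the coloured site carrier: the defect of the two lifted forward shifts through King's point pairing -/

section Device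

variable (K n : ℕ) (M : Fin (d + 1) → ℕ) [∀ μ, NeZero (M μ)] (ι : Type) [Fintype ι]

omit [NeZero L] [∀ μ, NeZero (M μ)] [Fintype ι] in
/-- The defect of the two lifted forward shifts, pointwise: `𝔇(S′_{+κ} ⊗ 1, S_{+κ} ⊗ 1)g(x′, i) = g(π(x′ + e′_κ), i) − g(πx′ + e_κ, i)`. [folklore] -/
theorem idef_shiftT_lift_apply (κ : Fin (d + 1)) (g : Tor (fine (L ^ K) M) × ι → ℝ) (p : Tor (fine (L ^ n * L ^ K) M) × ι) :
    idef (pull (liftMap (underPtN L K n M) ι)) (pull (liftMap (underPtN L K n M) ι)) (pull ⇑(liftEquiv (Equiv.addRight (unitVec (fine (L ^ n * L ^ K) M) κ)) ι))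
      (pull ⇑(liftEquiv (Equiv.addRight (unitVec (fine (L ^ K) M) κ)) ι)) g p =
      g (underPtN L K n M (p.1 + unitVec (fine (L ^ n * L ^ K) M) κ), p.2) - g (underPtN L K n M p.1 + unitVec (fine (L ^ K) M) κ, p.2) := rfl

/-- ★ **THE DEFECT OF THE TWO LIFTED FORWARD SHIFTS IS MAJORISED BY THE LIFTED ONE-STEP FORWARD DIFFERENCE** (coloured-site twin of part Σ-c `hasMaj_idefShiftT_comp` and of
dag-n15-c FILE 15 `hasMaj_idefFShift_comp_lift`): through King's point pairing lifted to `ι`-coloured site fields (the colour index a spectator), `𝔇(S′_{+κ} ⊗ 1, S_{+κ} ⊗ 1)∘T` has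
every block majorant `K ≥ 0` that `(S_{+κ} ⊗ 1 − 1)∘T` has — the defect VANISHES on the upper `κ`-face of the fibre and is minus the one-step forward difference inside it.
[cite: King1986, p.664 (pairing convention: the mechanism)] -/
theorem hasMaj_idefShiftT_comp_lift {Msz : ℝ} {F₁ : Type} [AddCommGroup F₁] [Module ℝ F₁] {b₁ : BlockNorm (unitTorusGeoS L K M Msz) F₁}
    {T : F₁ →ₗ[ℝ] (Tor (fine (L ^ K) M) × ι → ℝ)} {Kf : Tor M → Tor M → ℝ} (hK : ∀ y y', 0 ≤ Kf y y') (κ : Fin (d + 1))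
    (h : HasMaj b₁ (BlockNorm.ofBlocks (unitTorusGeoS L K M Msz) (liftBlk (blockOf (L ^ K) M) ι))
      ((pull ⇑(liftEquiv (Equiv.addRight (unitVec (fine (L ^ K) M) κ)) ι) - LinearMap.id) ∘ₗ T) Kf) :
    HasMaj b₁ (BlockNorm.ofBlocks (unitTorusGeoS L K M Msz) (liftBlk (blockOf (L ^ K) M ∘ underPtN L K n M) ι))
      (idef (pull (liftMap (underPtN L K n M) ι)) (pull (liftMap (underPtN L K n M) ι)) (pull ⇑(liftEquiv (Equiv.addRight (unitVec (fine (L ^ n * L ^ K) M) κ)) ι))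
        (pull ⇑(liftEquiv (Equiv.addRight (unitVec (fine (L ^ K) M) κ)) ι)) ∘ₗ T) Kf := by
  intro y' μ hμ y
  refine loc_ofBlocks_le (g := unitTorusGeoS L K M Msz) _ _ (mul_nonneg (hK y y') (b₁.loc_nonneg y' μ)) fun p hp => ?_
  rw [LinearMap.comp_apply, idef_shiftT_lift_apply]
  rcases underPtN_add_unitVec L K n M p.1 κ with hc | hc
  · -- inside the fibre: minus the one-step forward difference at the paired point, same colour component
    rw [hc]
    have hval : (((pull ⇑(liftEquiv (Equiv.addRight (unitVec (fine (L ^ K) M) κ)) ι) - LinearMap.id) ∘ₗ T : F₁ →ₗ[ℝ] (Tor (fine (L ^ K) M) × ι → ℝ)) μ)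
        (underPtN L K n M p.1, p.2) = T μ (underPtN L K n M p.1 + unitVec (fine (L ^ K) M) κ, p.2) - T μ (underPtN L K n M p.1, p.2) := rfl
    rw [show T μ (underPtN L K n M p.1, p.2) - T μ (underPtN L K n M p.1 + unitVec (fine (L ^ K) M) κ, p.2) =
      -((((pull ⇑(liftEquiv (Equiv.addRight (unitVec (fine (L ^ K) M) κ)) ι) - LinearMap.id) ∘ₗ T : F₁ →ₗ[ℝ] (Tor (fine (L ^ K) M) × ι → ℝ)) μ)
        (underPtN L K n M p.1, p.2)) by rw [hval, neg_sub], abs_neg]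
    have hx : liftBlk (blockOf (L ^ K) M) ι (underPtN L K n M p.1, p.2) = y := hp
    exact (abs_le_loc_ofBlocks (g := unitTorusGeoS L K M Msz) (liftBlk (blockOf (L ^ K) M) ι) _ hx).trans (h y' μ hμ y)
  · -- on the upper face: the two shifts are paired, the defect vanishes
    rw [hc, sub_self, abs_zero]
    exact mul_nonneg (hK y y') (b₁.loc_nonneg y' μ)

omit [NeZero L] in
/-- **THE LIFTED FORWARD SHIFT COSTS A FACTOR `e^{ρ}`** (coloured-site twin of part Σ-c `hasMaj_shiftT_comp`): if `T` has the block majorant `B·e^{−ρ|y−y′|_T}` (`B, ρ ≥ 0`) into the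
coloured site fields of fineness `N` blocked by King's unit blocks, then `(S_{+κ} ⊗ 1)∘T` has `B·e^{ρ}·e^{−ρ|y−y′|_T}` (the shifted point lies in the same or an adjacent unit block).
[cite: King1986, p.664 (unit blocks); Balaban1984PropagatorsII, (2.52)–(2.55) pp.232–233 (block-majorant bookkeeping, shape)] -/
theorem hasMaj_shiftT_comp_lift (N : ℕ) [NeZero N] (Msz : ℝ) {F₁ : Type} [AddCommGroup F₁] [Module ℝ F₁] {b₁ : BlockNorm (unitTorusGeoS L K M Msz) F₁}
    {T : F₁ →ₗ[ℝ] (Tor (fine N M) × ι → ℝ)} {B ρ : ℝ} (hB : 0 ≤ B) (hρ : 0 ≤ ρ) (κ : Fin (d + 1))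
    (h : HasMaj b₁ (BlockNorm.ofBlocks (unitTorusGeoS L K M Msz) (liftBlk (blockOf N M) ι)) T (fun y y' => B * Real.exp (-(ρ * tdistT M y y')))) :
    HasMaj b₁ (BlockNorm.ofBlocks (unitTorusGeoS L K M Msz) (liftBlk (blockOf N M) ι)) (pull ⇑(liftEquiv (Equiv.addRight (unitVec (fine N M) κ)) ι) ∘ₗ T)
      (fun y y' => B * Real.exp ρ * Real.exp (-(ρ * tdistT M y y'))) := by
  refine hasMaj_pull_comp (g := unitTorusGeoS L K M Msz) (liftBlk (blockOf N M) ι) ⇑(liftEquiv (Equiv.addRight (unitVec (fine N M) κ)) ι)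
    (fun _ _ => mul_nonneg (mul_nonneg hB (Real.exp_nonneg _)) (Real.exp_nonneg _)) (fun p y' => ?_) h
  show B * Real.exp (-(ρ * tdistT M (blockOf N M (p.1 + unitVec (fine N M) κ)) y')) ≤ B * Real.exp ρ * Real.exp (-(ρ * tdistT M (blockOf N M p.1) y'))
  rw [mul_assoc, ← Real.exp_add]
  refine mul_le_mul_of_nonneg_left (Real.exp_le_exp.mpr ?_) hB
  have h1 := tdistT_triangle M (blockOf N M p.1) (blockOf N M (p.1 + unitVec (fine N M) κ)) y'
  have h2 : tdistT M (blockOf N M p.1) (blockOf N M (p.1 + unitVec (fine N M) κ)) ≤ 1 := by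
    rw [tdistT_symm]; exact tdistT_blockOf_add_unitVec_le M N p.1 κ
  nlinarith

end Device

/-! ## §2 ★★ THE SHIFT-DEFECT ROW LETTER at King's full `A = 0` propagator `⊗ 1_ι`, colour-mixing coefficient operators -/

section Row

variable (ι : Type) [Fintype ι]

/-- ★★ **THE SHIFT-DEFECT ROW LETTER AT KING's FULL `A = 0` PROPAGATOR `⊗ 1_ι`** (the letter `hDSh` of dag-n15-c's `hasMaj_entry2_byParts_matrix₂_of_letters` on the coloured site
carrier; colour edition of part Σ-c ★★ `hasMaj_shiftDefect_kingS`, site twin of dag-n15-c FILE 15 ★★ `hasMaj_shiftDefect_fullGM`).  For odd `L ≥ 3`, `a > 0`, `0 ≤ m₀²`, `0 < α < 1`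
there are `δ, C > 0` such that for every `K ≥ 1`, `n`, cube `2L^e`, mass `0 < m² ≤ m₀²`, size datum, direction `κ` and every coefficient operator `C_a` on the coloured coarse site fields
INTERTWINING the lifted coarse shift — `(S_{+κ} ⊗ 1)∘C_a = C_a⁺∘(S_{+κ} ⊗ 1)` with `C_a ≤ diagK a₀`, `C_a⁺ − C_a ≤ diagK o₁` (`a₀, o₁ ≥ 0`; e.g. `C_a = M_{A∘τ_κ⁻¹}` a fibrewise-matrix
multiplication, dag-n15-c `pull_comp_mmulOp_translate'`) — with `Σ = Σ_ν ((A₀⁻¹ ⊗ 1)∘(N∇*_ν ⊗ 1)) pr_ν` (`∇*_ν ⊗ 1 = fgradAdj N (liftEquiv (· + e_ν) ι)`):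
`𝔇(S′_{+κ} ⊗ 1, S_{+κ} ⊗ 1)∘(C_a∘Σ) ≤ C·(o₁ + a₀·(L^K)^{−α})·e^{−δ|y−y′|_T}` from the colour- and component-lifted unit-block size to the coloured fine one (blocks through King's
pairing).  Content: §1 reduces to `(S_{+κ} ⊗ 1 − 1)∘(C_a∘Σ) = (C_a⁺ − C_a)(S_{+κ} ⊗ 1)Σ + C_a((S_{+κ} ⊗ 1) − 1)Σ`; the first term costs the oscillation letter × the plain letter of
`A₀⁻¹N∇*_ν` (Σ-a) `⊗ 1`, the second the Hölder step (Σ-c `hasMaj_oneStepFwd_kingSOp` ⇐ W-b) `⊗ 1`. [cite: Balaban1985BackgroundPropagators, Thm 3.1 (3.42)–(3.43) pp.397–398, (3.52) p.400, (3.64)–(3.65) p.402 (mechanism); Balaban1984PropagatorsII, (2.156) p.250; King1986, p.664 (pairing); Balaban1984PropagatorsI, Prop. 1.2 (1.110)–(1.111) p.35 (shape)] -/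
theorem hasMaj_shiftDefect_kingSM (hLodd : Odd L) (hL : 2 ≤ L) {a : ℝ} (ha : 0 < a) {m0sq : ℝ} (hm0 : 0 ≤ m0sq) {α : ℝ} (hα0 : 0 < α) (hα1 : α < 1) :
    ∃ δ C : ℝ, 0 < δ ∧ 0 < C ∧ ∀ (K : ℕ), 1 ≤ K → ∀ (n e : ℕ) (M : Fin (d + 1) → ℕ) [∀ μ, NeZero (M μ)], (∀ μ, M μ = 2 * L ^ e) →
      ∀ (msq : ℝ), 0 < msq → msq ≤ m0sq → ∀ (Msz : ℝ) (κ : Fin (d + 1))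
      (Ca Cap : (Tor (fine (L ^ K) M) × ι → ℝ) →ₗ[ℝ] (Tor (fine (L ^ K) M) × ι → ℝ)) (a₀ o₁ : ℝ), 0 ≤ a₀ → 0 ≤ o₁ →
      pull ⇑(liftEquiv (Equiv.addRight (unitVec (fine (L ^ K) M) κ)) ι) ∘ₗ Ca = Cap ∘ₗ pull ⇑(liftEquiv (Equiv.addRight (unitVec (fine (L ^ K) M) κ)) ι) →
      HasMaj (BlockNorm.ofBlocks (unitTorusGeoS L K M Msz) (liftBlk (blockOf (L ^ K) M) ι)) (BlockNorm.ofBlocks (unitTorusGeoS L K M Msz) (liftBlk (blockOf (L ^ K) M) ι)) Ca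
        (diagK fun _ => a₀) →
      HasMaj (BlockNorm.ofBlocks (unitTorusGeoS L K M Msz) (liftBlk (blockOf (L ^ K) M) ι)) (BlockNorm.ofBlocks (unitTorusGeoS L K M Msz) (liftBlk (blockOf (L ^ K) M) ι))
        (Cap - Ca) (diagK fun _ => o₁) →
      HasMaj (BlockNorm.ofBlocks (unitTorusGeoS L K M Msz) (liftBlk (liftBlk (blockOf (L ^ K) M) ι) (Fin (d + 1))))
        (BlockNorm.ofBlocks (unitTorusGeoS L K M Msz) (liftBlk (blockOf (L ^ K) M ∘ underPtN L K n M) ι))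
        (idef (pull (liftMap (underPtN L K n M) ι)) (pull (liftMap (underPtN L K n M) ι)) (pull ⇑(liftEquiv (Equiv.addRight (unitVec (fine (L ^ n * L ^ K) M) κ)) ι))
            (pull ⇑(liftEquiv (Equiv.addRight (unitVec (fine (L ^ K) M) κ)) ι)) ∘ₗ
          (Ca ∘ₗ sumJ fun ν => tensorId ι (kingGOp L a msq K (L ^ K) M) ∘ₗ
            fgradAdj ((L ^ K : ℕ) : ℝ) (liftEquiv (Equiv.addRight (unitVec (fine (L ^ K) M) ν)) ι)))
        (fun y y' => C * (o₁ + a₀ * ((L : ℝ) ^ K) ^ (-α)) * Real.exp (-(δ * tdistT M y y'))) := by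
  obtain ⟨C₁, δ₁, hC₁, hδ₁, HH⟩ := hasMaj_oneStepFwd_kingSOp (d := d) L hLodd hL ha hm0 hα0 hα1
  obtain ⟨C₀, δ₀, hC₀, hδ₀, H0⟩ := hasMaj_kingSOp (d := d) L hLodd hL ha hm0
  set δ : ℝ := min δ₀ δ₁ with hδdef
  have hδ : 0 < δ := lt_min hδ₀ hδ₁
  set C : ℝ := Real.exp δ * ((d + 1 : ℕ) * C₀) + (d + 1 : ℕ) * C₁ with hCdef
  have hC : 0 < C := by positivity
  refine ⟨δ, C, hδ, hC, fun K hK n e M _ hM msq hmsq hcap Msz κ Ca Cap a₀ o₁ ha₀ ho₁ hCaS hCa hOsc => ?_⟩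
  have hrα : 0 ≤ ((L : ℝ) ^ K) ^ (-α) := Real.rpow_nonneg (pow_nonneg (Nat.cast_nonneg _) _) _
  have hK0 : ∀ y y' : Tor M, 0 ≤ C₀ * Real.exp (-(δ * tdistT M y y')) := fun _ _ => mul_nonneg hC₀.le (Real.exp_nonneg _)
  have hK1 : ∀ y y' : Tor M, 0 ≤ C₁ * ((L : ℝ) ^ K) ^ (-α) * Real.exp (-(δ * tdistT M y y')) := fun _ _ => mul_nonneg (mul_nonneg hC₁.le hrα) (Real.exp_nonneg _)
  -- the plain letter of `S_ν ⊗ 1 = (A₀⁻¹ ⊗ 1)(N∇*_ν ⊗ 1)` at the common rate, of `Σ`, and of `(S_{+κ} ⊗ 1)Σ`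
  have hS : ∀ ν, HasMaj (BlockNorm.ofBlocks (unitTorusGeoS L K M Msz) (liftBlk (blockOf (L ^ K) M) ι)) (BlockNorm.ofBlocks (unitTorusGeoS L K M Msz) (liftBlk (blockOf (L ^ K) M) ι))
      (tensorId ι (kingGOp L a msq K (L ^ K) M) ∘ₗ fgradAdj ((L ^ K : ℕ) : ℝ) (liftEquiv (Equiv.addRight (unitVec (fine (L ^ K) M) ν)) ι))
      (fun y y' => C₀ * Real.exp (-(δ * tdistT M y y'))) := fun ν => by
    rw [comp_fgradAdj_liftEquiv, kingGOp_comp_fgradAdj]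
    exact hasMaj_tensorId ι hK0 (hasMaj_exp_weaken L hC₀.le le_rfl (min_le_left δ₀ δ₁) (H0 K hK e M hM msq hmsq hcap Msz ν))
  have hSig := hasMaj_sumJ_exp (g := unitTorusGeoS L K M Msz) (liftBlk (blockOf (L ^ K) M) ι)
    (b₂ := BlockNorm.ofBlocks (unitTorusGeoS L K M Msz) (liftBlk (blockOf (L ^ K) M) ι)) hC₀.le hS
  have hSsig := hasMaj_shiftT_comp_lift L K M ι (L ^ K) Msz
    (b₁ := BlockNorm.ofBlocks (unitTorusGeoS L K M Msz) (liftBlk (liftBlk (blockOf (L ^ K) M) ι) (Fin (d + 1))))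
    (mul_nonneg (Nat.cast_nonneg _) hC₀.le) hδ.le κ hSig
  -- term A: `(C_a⁺ − C_a)(S ⊗ 1)Σ ≤ o₁·|J|C₀e^{δ}·e^{−δd}`
  have hA := hasMaj_diagK_comp_exp (b₁ := BlockNorm.ofBlocks (unitTorusGeoS L K M Msz) (liftBlk (liftBlk (blockOf (L ^ K) M) ι) (Fin (d + 1))))
    (b₃ := BlockNorm.ofBlocks (unitTorusGeoS L K M Msz) (liftBlk (blockOf (L ^ K) M) ι)) (liftBlk (blockOf (L ^ K) M) ι) ho₁ hOsc hSsig
  -- term B: `C_a((S ⊗ 1) − 1)Σ ≤ a₀·|J|C₁(L^K)^{−α}·e^{−δd}` — the Hölder step of `A₀⁻¹N∇*`, tensored with `1_ι`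
  have hstep : ∀ ν, HasMaj (BlockNorm.ofBlocks (unitTorusGeoS L K M Msz) (liftBlk (blockOf (L ^ K) M) ι)) (BlockNorm.ofBlocks (unitTorusGeoS L K M Msz) (liftBlk (blockOf (L ^ K) M) ι))
      ((pull ⇑(liftEquiv (Equiv.addRight (unitVec (fine (L ^ K) M) κ)) ι) - LinearMap.id) ∘ₗ
        (tensorId ι (kingGOp L a msq K (L ^ K) M) ∘ₗ fgradAdj ((L ^ K : ℕ) : ℝ) (liftEquiv (Equiv.addRight (unitVec (fine (L ^ K) M) ν)) ι)))
      (fun y y' => C₁ * ((L : ℝ) ^ K) ^ (-α) * Real.exp (-(δ * tdistT M y y'))) := fun ν => by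
    rw [comp_fgradAdj_liftEquiv, sub_id_comp_tensorId, kingGOp_comp_fgradAdj]
    exact hasMaj_tensorId ι hK1 (hasMaj_exp_weaken L (mul_nonneg hC₁.le hrα) le_rfl (min_le_right δ₀ δ₁) (HH K hK e M hM msq hmsq hcap Msz κ ν))
  have hSig' := hasMaj_sumJ_exp (g := unitTorusGeoS L K M Msz) (liftBlk (blockOf (L ^ K) M) ι)
    (b₂ := BlockNorm.ofBlocks (unitTorusGeoS L K M Msz) (liftBlk (blockOf (L ^ K) M) ι)) (mul_nonneg hC₁.le hrα) hstep
  have hSig'' := hSig'.congr fun u => (LinearMap.congr_fun (comp_sumJ (pull ⇑(liftEquiv (Equiv.addRight (unitVec (fine (L ^ K) M) κ)) ι) - LinearMap.id)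
    (fun ν => tensorId ι (kingGOp L a msq K (L ^ K) M) ∘ₗ fgradAdj ((L ^ K : ℕ) : ℝ) (liftEquiv (Equiv.addRight (unitVec (fine (L ^ K) M) ν)) ι))) u).symm
  have hB := hasMaj_diagK_comp_exp (b₁ := BlockNorm.ofBlocks (unitTorusGeoS L K M Msz) (liftBlk (liftBlk (blockOf (L ^ K) M) ι) (Fin (d + 1))))
    (b₃ := BlockNorm.ofBlocks (unitTorusGeoS L K M Msz) (liftBlk (blockOf (L ^ K) M) ι)) (liftBlk (blockOf (L ^ K) M) ι) ha₀ hCa hSig''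
  have hkey : o₁ * (((Fintype.card (Fin (d + 1)) : ℕ) : ℝ) * C₀ * Real.exp δ) + a₀ * (((Fintype.card (Fin (d + 1)) : ℕ) : ℝ) * (C₁ * ((L : ℝ) ^ K) ^ (-α))) ≤
      C * (o₁ + a₀ * ((L : ℝ) ^ K) ^ (-α)) := by
    rw [Fintype.card_fin, hCdef]
    have h1 : 0 ≤ ((d + 1 : ℕ) : ℝ) * C₁ * o₁ := by positivity
    have h2 : 0 ≤ Real.exp δ * (((d + 1 : ℕ) : ℝ) * C₀) * (a₀ * ((L : ℝ) ^ K) ^ (-α)) := by positivity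
    nlinarith
  have hsum := (hasMaj_add_exp hA hB).mono fun y y' => (mul_le_mul_of_nonneg_right hkey (Real.exp_nonneg (-(δ * tdistT M y y'))))
  -- the device: it suffices to majorise `((S ⊗ 1) − 1)∘(C_a∘Σ) = (C_a⁺ − C_a)(S ⊗ 1)Σ + C_a((S ⊗ 1) − 1)Σ`
  exact hasMaj_idefShiftT_comp_lift L K n M ι (b₁ := BlockNorm.ofBlocks (unitTorusGeoS L K M Msz) (liftBlk (liftBlk (blockOf (L ^ K) M) ι) (Fin (d + 1))))
    (fun _ _ => mul_nonneg (mul_nonneg hC.le (by positivity)) (Real.exp_nonneg _)) κ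
    (hsum.congr fun u => (LinearMap.congr_fun (sub_id_comp_comp_eq _ Ca Cap _ hCaS) u).symm)

end Row

/-! ## §3 ★★ The letter on the CLOSED mass range `0 ≤ m² ≤ m₀²` (the site layer's `m² = 0` included) -/

section MassRange

variable (ι : Type) [Fintype ι]

omit [NeZero L] in
/-- A fixed linear map of finitely many real coordinates applied to a one-parameter family of vectors whose coordinates are continuous at `0` is continuous at `0`
in every coordinate (`C v = Σ_i v_i·C e_i`). [folklore] -/
theorem continuousAt_linearMap_apply_of_coords {Y : Type} [Fintype Y] (Ca : (Y → ℝ) →ₗ[ℝ] (Y → ℝ)) (v : ℝ → (Y → ℝ))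
    (hv : ∀ p, ContinuousAt (fun m : ℝ => v m p) 0) (q : Y) : ContinuousAt (fun m : ℝ => Ca (v m) q) 0 := by
  classical
  have h : ∀ m, Ca (v m) q = ∑ i, v m i * Ca (fun j => if i = j then (1 : ℝ) else 0) q := fun m => by
    rw [LinearMap.pi_apply_eq_sum_univ Ca (v m), Finset.sum_apply]
    simp only [Pi.smul_apply, smul_eq_mul]
  simp only [h]
  exact tendsto_finsetSum _ fun i _ => (hv i).mul continuousAt_const

/-- Every matrix element `m² ↦ (𝔇(S′_{+κ} ⊗ 1, S_{+κ} ⊗ 1)∘(C_a∘Σ(m²))μ)(x′, i)` of the shift-defect operator of §2 is continuous at `m² = 0` (`Σ(m²) = Σ_ν((A₀(a_K, N², m²)⁻¹ ⊗ 1)(N∇*_ν ⊗ 1))pr_ν`;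
part VII `continuousAt_kingGOp_mass`: the massless `A₀` is invertible, `a > 0`, `L > 1`, `K ≥ 1`). [cite: King1986, (4.1)–(4.5) p.670; Balaban1984PropagatorsI, p.25 («its inverse is a bounded operator G′»)] -/
theorem continuousAt_shiftDefect_kingSM_mass (hL : 1 < L) {a : ℝ} (ha : 0 < a) {K : ℕ} (hK : 1 ≤ K) (n : ℕ) (M : Fin (d + 1) → ℕ) [∀ μ, NeZero (M μ)] (κ : Fin (d + 1))
    (Ca : (Tor (fine (L ^ K) M) × ι → ℝ) →ₗ[ℝ] (Tor (fine (L ^ K) M) × ι → ℝ)) (μ : (Tor (fine (L ^ K) M) × ι) × Fin (d + 1) → ℝ) (p : Tor (fine (L ^ n * L ^ K) M) × ι) :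
    ContinuousAt (fun m2 : ℝ =>
      (idef (pull (liftMap (underPtN L K n M) ι)) (pull (liftMap (underPtN L K n M) ι)) (pull ⇑(liftEquiv (Equiv.addRight (unitVec (fine (L ^ n * L ^ K) M) κ)) ι))
          (pull ⇑(liftEquiv (Equiv.addRight (unitVec (fine (L ^ K) M) κ)) ι)) ∘ₗ
        (Ca ∘ₗ sumJ fun ν => tensorId ι (kingGOp L a m2 K (L ^ K) M) ∘ₗ
          fgradAdj ((L ^ K : ℕ) : ℝ) (liftEquiv (Equiv.addRight (unitVec (fine (L ^ K) M) ν)) ι))) μ p) 0 := by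
  have hv : ∀ q : Tor (fine (L ^ K) M) × ι, ContinuousAt (fun m2 : ℝ => (sumJ fun ν => tensorId ι (kingGOp L a m2 K (L ^ K) M) ∘ₗ
      fgradAdj ((L ^ K : ℕ) : ℝ) (liftEquiv (Equiv.addRight (unitVec (fine (L ^ K) M) ν)) ι)) μ q) 0 := fun q => by
    simp only [sumJ_apply, Finset.sum_apply, LinearMap.comp_apply, tensorId_apply]
    exact tendsto_finsetSum _ fun ν _ => continuousAt_kingGOp_mass M (L ^ K) L hL ha hK _ q.1
  simp only [LinearMap.comp_apply, idef_apply, Pi.sub_apply, pull_apply]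
  exact (continuousAt_linearMap_apply_of_coords Ca _ hv _).sub (continuousAt_linearMap_apply_of_coords Ca _ hv _)

/-- ★★ **THE SHIFT-DEFECT ROW LETTER `⊗ 1_ι` ON THE CLOSED MASS RANGE `0 ≤ m² ≤ m₀²`** (§2 on `(0, m₀² + 1]`; at `m² = 0` — the site layer's mass — its limit by part VII
`hasMaj_ofBlocks_of_massLimit` and `continuousAt_shiftDefect_kingSM_mass`): same binders and conclusion as `hasMaj_shiftDefect_kingSM` with `0 < m²` replaced by `0 ≤ m²`.
[cite: Balaban1985BackgroundPropagators, Thm 3.1 (3.42)–(3.43) pp.397–398, (3.64)–(3.65) p.402 (mechanism); King1986, p.664 (pairing), (4.1)–(4.5) p.670; Balaban1984PropagatorsI, Prop. 1.2 (1.110)–(1.111) p.35 (shape), p.25 (massless `G′`)] -/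
theorem hasMaj_shiftDefect_kingSM_massRange (hLodd : Odd L) (hL : 2 ≤ L) {a : ℝ} (ha : 0 < a) {m0sq : ℝ} (hm0 : 0 ≤ m0sq) {α : ℝ} (hα0 : 0 < α) (hα1 : α < 1) :
    ∃ δ C : ℝ, 0 < δ ∧ 0 < C ∧ ∀ (K : ℕ), 1 ≤ K → ∀ (n e : ℕ) (M : Fin (d + 1) → ℕ) [∀ μ, NeZero (M μ)], (∀ μ, M μ = 2 * L ^ e) →
      ∀ (msq : ℝ), 0 ≤ msq → msq ≤ m0sq → ∀ (Msz : ℝ) (κ : Fin (d + 1))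
      (Ca Cap : (Tor (fine (L ^ K) M) × ι → ℝ) →ₗ[ℝ] (Tor (fine (L ^ K) M) × ι → ℝ)) (a₀ o₁ : ℝ), 0 ≤ a₀ → 0 ≤ o₁ →
      pull ⇑(liftEquiv (Equiv.addRight (unitVec (fine (L ^ K) M) κ)) ι) ∘ₗ Ca = Cap ∘ₗ pull ⇑(liftEquiv (Equiv.addRight (unitVec (fine (L ^ K) M) κ)) ι) →
      HasMaj (BlockNorm.ofBlocks (unitTorusGeoS L K M Msz) (liftBlk (blockOf (L ^ K) M) ι)) (BlockNorm.ofBlocks (unitTorusGeoS L K M Msz) (liftBlk (blockOf (L ^ K) M) ι)) Ca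
        (diagK fun _ => a₀) →
      HasMaj (BlockNorm.ofBlocks (unitTorusGeoS L K M Msz) (liftBlk (blockOf (L ^ K) M) ι)) (BlockNorm.ofBlocks (unitTorusGeoS L K M Msz) (liftBlk (blockOf (L ^ K) M) ι))
        (Cap - Ca) (diagK fun _ => o₁) →
      HasMaj (BlockNorm.ofBlocks (unitTorusGeoS L K M Msz) (liftBlk (liftBlk (blockOf (L ^ K) M) ι) (Fin (d + 1))))
        (BlockNorm.ofBlocks (unitTorusGeoS L K M Msz) (liftBlk (blockOf (L ^ K) M ∘ underPtN L K n M) ι))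
        (idef (pull (liftMap (underPtN L K n M) ι)) (pull (liftMap (underPtN L K n M) ι)) (pull ⇑(liftEquiv (Equiv.addRight (unitVec (fine (L ^ n * L ^ K) M) κ)) ι))
            (pull ⇑(liftEquiv (Equiv.addRight (unitVec (fine (L ^ K) M) κ)) ι)) ∘ₗ
          (Ca ∘ₗ sumJ fun ν => tensorId ι (kingGOp L a msq K (L ^ K) M) ∘ₗ
            fgradAdj ((L ^ K : ℕ) : ℝ) (liftEquiv (Equiv.addRight (unitVec (fine (L ^ K) M) ν)) ι)))
        (fun y y' => C * (o₁ + a₀ * ((L : ℝ) ^ K) ^ (-α)) * Real.exp (-(δ * tdistT M y y'))) := by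
  obtain ⟨δ, C, hδ, hC, H⟩ := hasMaj_shiftDefect_kingSM (d := d) L ι hLodd hL ha (show (0 : ℝ) ≤ m0sq + 1 by linarith) hα0 hα1
  refine ⟨δ, C, hδ, hC, fun K hK n e M _ hM msq hmsq hcap Msz κ Ca Cap a₀ o₁ ha₀ ho₁ hCaS hCa hOsc => ?_⟩
  have hL1 : 1 < L := by omega
  have hm1 : (0 : ℝ) < m0sq + 1 := by linarith
  rcases hmsq.lt_or_eq with hpos | h0
  · exact H K hK n e M hM msq hpos (by linarith) Msz κ Ca Cap a₀ o₁ ha₀ ho₁ hCaS hCa hOsc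
  · subst h0
    exact hasMaj_ofBlocks_of_massLimit (g := unitTorusGeoS L K M Msz) (liftBlk (liftBlk (blockOf (L ^ K) M) ι) (Fin (d + 1))) (liftBlk (blockOf (L ^ K) M ∘ underPtN L K n M) ι)
      (fun m2 : ℝ => idef (pull (liftMap (underPtN L K n M) ι)) (pull (liftMap (underPtN L K n M) ι))
          (pull ⇑(liftEquiv (Equiv.addRight (unitVec (fine (L ^ n * L ^ K) M) κ)) ι)) (pull ⇑(liftEquiv (Equiv.addRight (unitVec (fine (L ^ K) M) κ)) ι)) ∘ₗ
        (Ca ∘ₗ sumJ fun ν => tensorId ι (kingGOp L a m2 K (L ^ K) M) ∘ₗ fgradAdj ((L ^ K : ℕ) : ℝ) (liftEquiv (Equiv.addRight (unitVec (fine (L ^ K) M) ν)) ι)))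
      _ hm1 (fun μ p => continuousAt_shiftDefect_kingSM_mass L ι hL1 ha hK n M κ Ca μ p)
      (fun m2 hm2 hcap2 => H K hK n e M hM m2 hm2 hcap2 Msz κ Ca Cap a₀ o₁ ha₀ ho₁ hCaS hCa hOsc)

end MassRange

end Summit.QuantumFields.YangMills.BalabanUVNodes.N15.KingModel

end
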